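import Literature.Probability.NegativeDependence.RayleighMatrices
import Literature.LinearAlgebra.Matrix.TotallyNonnegative
import HarnessLib

/-!
# A totally positive matrix that is not a Rayleigh matrix: `B + I` fails the Hadamard–Fischer–Kotelyansky
# inequalities and `μ_B` is not negatively associated (Borcea–Brändén–Liggett §3.2, the matrix `B` of (3.3))

J. Borcea, P. Brändén, T. M. Liggett, *Negative dependence and the geometry of polynomials*, J. Amer. Math. Soc.
22 (2009) 521–567 (arXiv:0707.2340, held `paper:arxiv-0707.2340`, arXiv numbering), §3.2 (arXiv pp. 11–12),
verbatim:

> Examples of GKK-matrices are: (I) Positive definite matrices; (II) Totally positive matrices, i.e., matrices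
> for which all minors are positive; (III) Non-singular `M`-matrices […]. It follows immediately from Theorem 3.3
> that non-singular `M`-matrices and positive definite matrices are Rayleigh. Now for any `s, t ∈ (0,1)` one can
> easily check that the matrix `B = [[1, 1/2, s/4], [1/2, 1, 1/2], [t/4, 1/2, 1]]` (3.3) is totally positive. Given
> an `n × n` matrix `A` and two subsets `S, T ⊆ [n]` of the same size we let `A(S,T)` denote the minor of `A`
> lying in rows indexed by `S` and columns indexed by `T`. It was proved by Gantmacher–Krein [GK] and Carlson [Ca]
> that a necessary and sufficient condition for a P-matrix to be GKK is that `A(S,T) A(T,S) ≥ 0` for any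
> `S, T ⊆ [n]` with `|S| = |T| = |S ∪ T| − 1`. Since `(B+I)(12,23) = (1−2s)/4` and `(B+I)(23,12) = (1−2t)/4` we
> may choose `s, t ∈ (0,1)` so that `(B+I)(12,23) (B+I)(23,12) < 0`. We conclude that for such values of `s, t`
> the matrix `B + I` fails to be GKK. […] Again, negative association fails for measures associated with totally
> positive matrices. Indeed, let `B` be the totally positive `3 × 3` matrix defined in (3.3) and fix `s, t ∈ (0,1)`
> such that `A := B + I` is not GKK (see the above discussion). It is known [Ca, GK] that an `n × n` P-matrix `C`
> is GKK if and only if `C⟨S ∪ {i}⟩ · C⟨S ∪ {j}⟩ ≥ C⟨S ∪ {i,j}⟩ · C⟨S⟩` (3.4) for all `S ⊆ [n]` and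
> `i, j ∈ [n] ∖ S` with `i ≠ j`. Hence, since `A` fails to be GKK it follows that (3.4) fails for `A` and some
> `S, i, j`. Unraveling the definitions this means that for some principal submatrix `B′` of `B` the
> corresponding measure `μ_{B′}` will fail to have pairwise negatively correlated variables (cf. Definition 2.8).
> In particular, since NA ⇒ p-NC, the measure `μ_{B′}` cannot be negatively associated.

## What is here (vocabulary of `RayleighMatrices` — `principalMinorMap A S = det A[S]`, `coMinorWeight A S = A⟨S⟩
## = det A[Sᶜ]` (the unnormalised `μ_A`), `IsPMatrix`, `IsGKK`, `IsRayleighMatrix` — and of the tree's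
## Fallat–Johnson file `LinearAlgebra/Matrix/TotallyNonnegative` — `IsTP`; indices `0, 1, 2` for the printed
## `1, 2, 3`)

* §1 small principal minors in the vocabulary of `principalMinorMap`: `principalMinorMap_singleton` (`A[{i}] = a_ii`),
  `principalMinorMap_pair` (`det A[{i,j}] = a_ii a_jj − a_ij a_ji`), `principalMinorMap_eq_det_submatrix_orderEmbOfFin`
  (the increasing re-indexing), hence **`IsTP.isPMatrix`** (a totally positive matrix is a P-matrix) and
  `translW_one_apply` / `sum_filter_mem_mem_eq` / `sum_filter_mem_eq` (the pairwise-correlation sums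
  `Σ_{S ∋ i,j} μ_A(S)`, `Σ_{S ∋ i} μ_A(S)`, `Σ_S μ_A(S)` are the co-minors `(A+I)⟨i,j⟩`, `(A+I)⟨i⟩`, `(A+I)⟨∅⟩`,
  tree `coMinorWeight_add_diagonal`).
* §2 the matrix **`bblMatrixB s t`** of (3.3); **`isTP_bblMatrixB`** («for any `s, t ∈ (0,1)` … `B` is totally
  positive»: all twenty minors); `bblMatrixB_add_one`; the two printed almost-principal minors
  **`det_bblMatrixB_add_one_rows01_cols12`** (`(B+I)(12,23) = (1−2s)/4`), **`det_bblMatrixB_add_one_rows12_cols01`**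
  (`(B+I)(23,12) = (1−2t)/4`); the four co-minors of `A = B + I` entering (3.4) at `S = ∅`, `i = 1`, `j = 3`
  (`coMinorWeight_bblMatrixB_add_one_*`) and the identity **`koteljanskiiGap_bblMatrixB_add_one`**:
  `A⟨1⟩ A⟨3⟩ − A⟨1,3⟩ A⟨∅⟩ = (B+I)(12,23) · (B+I)(23,12) = (1−2s)(1−2t)/16` (the Gantmacher–Krein–Carlson
  quantity, here by direct computation).
* §3 consequences for `(1−2s)(1−2t) < 0` (e.g. `s < 1/2 < t`): **`not_isGKK_bblMatrixB_add_one`** («`B + I` fails to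
  be GKK»), **`not_isRayleighMatrix_bblMatrixB`** and `not_isRayleigh_coMinorWeight_bblMatrixB` (a TP matrix that is
  not Rayleigh — Thm. 3.3, tree `IsRayleighMatrix.add_diagonal`), **`not_isPairwiseNC_coMinorWeight_bblMatrixB`**
  (`μ_B` fails p-NC at the pair `(1,3)`: here `S = ∅`, so `B′ = B`) and **`not_isNegAssoc_coMinorWeight_bblMatrixB`**
  («negative association fails for measures associated with totally positive matrices», tree
  `IsNegAssoc.isPairwiseNC`); `bblMatrixB_example` (the admissible choice `s = 1/4`, `t = 3/4`).

One definition with body (the printed matrix `B`); theorems otherwise; no named fact, no instance, no notation. The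
Gantmacher–Krein–Carlson criterion itself is not used (the failing inequality is exhibited directly).

## References

* [BorceaBrandenLiggett2007] — §3.2, (3.3), (3.4), Def. 2.8, Def. 3.1, Thm. 3.3.
* [FallatJohnson2011] S. M. Fallat, C. R. Johnson, *Totally Nonnegative Matrices*, §0.0 (TP), §6.0 (6.5) (the
  almost-principal-minor condition; the tree's `IsTP`).
-/

noncomputable section

open Finset Matrix
open Literature.LinearAlgebra.Matrix

namespace Literature.Probability.NegativeDependence

/-! ## §1 Small principal minors; TP ⟹ P-matrix; the pairwise-correlation sums as co-minors of `A + I` -/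

section PrincipalMinors

variable {n : Type*} [Fintype n] [DecidableEq n] {R : Type*} [CommRing R]

/-- `det A[{i}] = a_ii`. [cite: BorceaBrandenLiggett2007, §3.2 (principal minors `A[S]`)] -/
theorem principalMinorMap_singleton (A : Matrix n n R) (i : n) : principalMinorMap A {i} = A i i := by
  unfold principalMinorMap
  let e : Fin 1 ≃ (↥({i} : Finset n)) :=
    { toFun := fun _ => ⟨i, mem_singleton_self i⟩
      invFun := fun _ => 0
      left_inv := fun k => by fin_cases k; rfl
      right_inv := fun x => by
        obtain ⟨x, hx⟩ := x
        exact Subtype.ext (mem_singleton.1 hx).symm }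
  rw [← det_submatrix_equiv_self e, det_fin_one]
  rfl

/-- `det A[{i,j}] = a_ii a_jj − a_ij a_ji` for `i ≠ j`. [cite: BorceaBrandenLiggett2007, §3.2 (principal minors
`A[S]`)] -/
theorem principalMinorMap_pair (A : Matrix n n R) {i j : n} (hij : i ≠ j) :
    principalMinorMap A {i, j} = A i i * A j j - A i j * A j i := by
  unfold principalMinorMap
  have hi : i ∈ ({i, j} : Finset n) := by simp
  have hj : j ∈ ({i, j} : Finset n) := by simp
  let e : Fin 2 ≃ (↥({i, j} : Finset n)) :=
    { toFun := fun k => if k = 0 then ⟨i, hi⟩ else ⟨j, hj⟩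
      invFun := fun x => if (x : n) = i then 0 else 1
      left_inv := fun k => by fin_cases k <;> simp [hij.symm]
      right_inv := fun x => by
        obtain ⟨x, hx⟩ := x
        simp only [mem_insert, mem_singleton] at hx
        rcases hx with rfl | rfl
        · simp
        · simp [hij.symm] }
  rw [← det_submatrix_equiv_self e, det_fin_two]
  simp [e]

/-- Principal minors through the increasing enumeration of the index set: `det A[S] = det (a_{s_a s_b})_{a,b < |S|}`,
`s_0 < s_1 < ⋯` the elements of `S`. [cite: FallatJohnson2011, §0.0 (minors with increasing index sets)] -/
theorem principalMinorMap_eq_det_submatrix_orderEmbOfFin [LinearOrder n] (A : Matrix n n R) (S : Finset n) {k : ℕ}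
    (h : S.card = k) : principalMinorMap A S = (A.submatrix (S.orderEmbOfFin h) (S.orderEmbOfFin h)).det := by
  unfold principalMinorMap
  rw [← det_submatrix_equiv_self (S.orderIsoOfFin h).toEquiv, submatrix_submatrix]
  rfl

/-- **A totally positive matrix is a P-matrix** (its principal minors are among its minors).
[cite: BorceaBrandenLiggett2007, §3.2 («(II) Totally positive matrices» among the P-matrices); FallatJohnson2011,
§0.0] -/
theorem _root_.Literature.LinearAlgebra.Matrix.IsTP.isPMatrix {m : Type*} [Fintype m] [LinearOrder m]
    {A : Matrix m m ℝ} (h : IsTP A) : IsPMatrix A := fun S => by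
  rw [principalMinorMap_eq_det_submatrix_orderEmbOfFin A S rfl]
  exact h _ _ _ (S.orderEmbOfFin rfl).strictMono (S.orderEmbOfFin rfl).strictMono

/-- The translate by `𝟙` sums over supersets: `(translW 𝟙 μ)(S) = Σ_{T ⊇ S} μ(T)`. [cite: BorceaBrandenLiggett2007,
§2.1 Prop. 2.1 (2) (`f(z + 𝟙)`)] -/
theorem translW_one_apply (μ : Finset n → ℝ) (S : Finset n) :
    translW (fun _ => (1 : ℝ)) μ S = ∑ T ∈ univ.filter (fun T : Finset n => S ⊆ T), μ T := by
  rw [translW_apply, sum_filter]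
  refine sum_congr rfl fun T _ => ?_
  split_ifs <;> simp

/-- **`Σ_{S ∋ i, j} μ_A(S) = (A + I)⟨i,j⟩`.** [cite: BorceaBrandenLiggett2007, §3.2 («unraveling the definitions»:
p-NC of `μ_{B′}` versus (3.4) for `A = B + I`)] -/
theorem sum_filter_mem_mem_eq (A : Matrix n n ℝ) (i j : n) :
    ∑ S ∈ univ.filter (fun S : Finset n => i ∈ S ∧ j ∈ S), coMinorWeight A S = coMinorWeight (A + 1) {i, j} := by
  have h1 : (A + 1 : Matrix n n ℝ) = A + diagonal fun _ => 1 := by rw [diagonal_one]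
  rw [h1, coMinorWeight_add_diagonal, translW_one_apply]
  congr 1
  ext S
  simp [insert_subset_iff]

/-- **`Σ_{S ∋ i} μ_A(S) = (A + I)⟨i⟩`.** [cite: BorceaBrandenLiggett2007, §3.2 (same)] -/
theorem sum_filter_mem_eq (A : Matrix n n ℝ) (i : n) :
    ∑ S ∈ univ.filter (fun S : Finset n => i ∈ S), coMinorWeight A S = coMinorWeight (A + 1) {i} := by
  have h1 : (A + 1 : Matrix n n ℝ) = A + diagonal fun _ => 1 := by rw [diagonal_one]
  rw [h1, coMinorWeight_add_diagonal, translW_one_apply]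
  congr 1
  ext S
  simp

/-- **`Σ_S μ_A(S) = (A + I)⟨∅⟩ = det(A + I)`.** [cite: BorceaBrandenLiggett2007, §3.2 (`μ_A(S) = A⟨S⟩ det(A+I)^{−1}`)] -/
theorem sum_coMinorWeight_eq (A : Matrix n n ℝ) : ∑ S, coMinorWeight A S = coMinorWeight (A + 1) ∅ := by
  have h1 : (A + 1 : Matrix n n ℝ) = A + diagonal fun _ => 1 := by rw [diagonal_one]
  rw [h1, coMinorWeight_add_diagonal, translW_one_apply]
  rw [filter_true_of_mem fun T _ => empty_subset T]

end PrincipalMinors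

/-! ## §2 The matrix `B` of (3.3): total positivity, the two almost-principal minors of `B + I`, the co-minors -/

section MatrixB

variable (s t : ℝ)

/-- **The matrix `B` of (3.3)**: `B = [[1, 1/2, s/4], [1/2, 1, 1/2], [t/4, 1/2, 1]]`.
[cite: BorceaBrandenLiggett2007, §3.2 eq. (3.3)] -/
def bblMatrixB : Matrix (Fin 3) (Fin 3) ℝ := !![1, 1/2, s/4; 1/2, 1, 1/2; t/4, 1/2, 1]

/-- Unfolding (3.3). [cite: BorceaBrandenLiggett2007, §3.2 eq. (3.3)] -/
theorem bblMatrixB_eq : bblMatrixB s t = !![1, 1/2, s/4; 1/2, 1, 1/2; t/4, 1/2, 1] := rfl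

/-- `det B = 1/2 + (s + t − st)/16`. [cite: BorceaBrandenLiggett2007, §3.2 eq. (3.3)] -/
theorem det_bblMatrixB : (bblMatrixB s t).det = 1 / 2 + (s + t - s * t) / 16 := by
  rw [bblMatrixB_eq, det_fin_three]
  simp
  ring

/-- A strictly increasing pair in `Fin 3` is `(0,1)`, `(0,2)` or `(1,2)`. [folklore] -/
private theorem fin3_pairs {f : Fin 2 → Fin 3} (hf : StrictMono f) :
    (f 0 = 0 ∧ f 1 = 1) ∨ (f 0 = 0 ∧ f 1 = 2) ∨ (f 0 = 1 ∧ f 1 = 2) := by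
  have h01 : f 0 < f 1 := hf (by decide)
  generalize f 0 = a at h01 ⊢
  generalize f 1 = b at h01 ⊢
  fin_cases a <;> fin_cases b <;> simp_all (config := { decide := true })

/-- A strictly increasing self-map of `Fin 3` is the identity. [folklore] -/
private theorem fin3_triple {f : Fin 3 → Fin 3} (hf : StrictMono f) : f = id := by
  have h01 : f 0 < f 1 := hf (by decide)
  have h12 : f 1 < f 2 := hf (by decide)
  suffices h : f 0 = 0 ∧ f 1 = 1 ∧ f 2 = 2 by
    funext i
    fin_cases i
    · exact h.1
    · exact h.2.1
    · exact h.2.2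
  generalize f 0 = a at h01 ⊢
  generalize f 1 = b at h01 h12 ⊢
  generalize f 2 = c at h12 ⊢
  fin_cases a <;> fin_cases b <;> fin_cases c <;> simp_all (config := { decide := true })

/-- **«For any `s, t ∈ (0,1)` one can easily check that the matrix `B` is totally positive»**: all twenty minors
of `B` (nine entries, nine `2 × 2` minors, `det B = 1/2 + (s+t−st)/16`, and the empty minor) are positive.
[cite: BorceaBrandenLiggett2007, §3.2 (after Thm. 3.3); FallatJohnson2011, §0.0 (TP)] -/
theorem isTP_bblMatrixB (hs0 : 0 < s) (hs1 : s < 1) (ht0 : 0 < t) (ht1 : t < 1) : IsTP (bblMatrixB s t) := by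
  intro k r c hr hc
  have hk : k ≤ 3 := by simpa using Fintype.card_le_of_injective r hr.injective
  interval_cases k
  · -- the empty minor
    simp [det_isEmpty]
  · -- entries
    rw [det_unique]
    simp only [submatrix_apply, Fin.default_eq_zero]
    generalize r 0 = a
    generalize c 0 = b
    fin_cases a <;> fin_cases b <;> simp [bblMatrixB] <;> positivity
  · -- 2 × 2 minors
    rw [det_fin_two]
    simp only [submatrix_apply]
    rcases fin3_pairs hr with ⟨ha0, ha1⟩ | ⟨ha0, ha1⟩ | ⟨ha0, ha1⟩ <;>
      rcases fin3_pairs hc with ⟨hb0, hb1⟩ | ⟨hb0, hb1⟩ | ⟨hb0, hb1⟩ <;>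
        simp [ha0, ha1, hb0, hb1, bblMatrixB] <;> nlinarith
  · -- the determinant
    rw [fin3_triple hr, fin3_triple hc]
    change 0 < (bblMatrixB s t).det
    rw [det_bblMatrixB]
    nlinarith

/-- `B` is a P-matrix. [cite: BorceaBrandenLiggett2007, §3.2] -/
theorem isPMatrix_bblMatrixB (hs0 : 0 < s) (hs1 : s < 1) (ht0 : 0 < t) (ht1 : t < 1) : IsPMatrix (bblMatrixB s t) :=
  (isTP_bblMatrixB s t hs0 hs1 ht0 ht1).isPMatrix

/-- `A = B + I = [[2, 1/2, s/4], [1/2, 2, 1/2], [t/4, 1/2, 2]]`. [cite: BorceaBrandenLiggett2007, §3.2 (`A := B + I`)] -/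
theorem bblMatrixB_add_one : bblMatrixB s t + 1 = !![2, 1/2, s/4; 1/2, 2, 1/2; t/4, 1/2, 2] := by
  ext i j
  fin_cases i <;> fin_cases j <;> simp [bblMatrixB, one_apply] <;> norm_num

/-- **`(B+I)(12,23) = (1 − 2s)/4`** (rows `1,2`, columns `2,3` in the printed numbering).
[cite: BorceaBrandenLiggett2007, §3.2 («Since (B+I)(12,23) = (1−2s)/4»)] -/
theorem det_bblMatrixB_add_one_rows01_cols12 :
    ((bblMatrixB s t + 1).submatrix ![0, 1] ![1, 2]).det = (1 - 2 * s) / 4 := by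
  rw [bblMatrixB_add_one, det_fin_two]
  simp
  ring

/-- **`(B+I)(23,12) = (1 − 2t)/4`** (rows `2,3`, columns `1,2` in the printed numbering).
[cite: BorceaBrandenLiggett2007, §3.2 («and (B+I)(23,12) = (1−2t)/4»)] -/
theorem det_bblMatrixB_add_one_rows12_cols01 :
    ((bblMatrixB s t + 1).submatrix ![1, 2] ![0, 1]).det = (1 - 2 * t) / 4 := by
  rw [bblMatrixB_add_one, det_fin_two]
  simp
  ring

/-- `A⟨∅⟩ = det(B + I) = 7 + (s+t)/16 − st/8`. [cite: BorceaBrandenLiggett2007, §3.2 (3.4)] -/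
theorem coMinorWeight_bblMatrixB_add_one_empty :
    coMinorWeight (bblMatrixB s t + 1) ∅ = 7 + (s + t) / 16 - s * t / 8 := by
  rw [coMinorWeight_empty, bblMatrixB_add_one, det_fin_three]
  simp
  ring

/-- `A⟨1⟩ = det A[{2,3}] = 15/4`. [cite: BorceaBrandenLiggett2007, §3.2 (3.4)] -/
theorem coMinorWeight_bblMatrixB_add_one_zero : coMinorWeight (bblMatrixB s t + 1) {0} = 15 / 4 := by
  rw [coMinorWeight_apply, show ({0} : Finset (Fin 3))ᶜ = {1, 2} by decide,
    principalMinorMap_pair _ (by decide), bblMatrixB_add_one]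
  simp
  norm_num

/-- `A⟨3⟩ = det A[{1,2}] = 15/4`. [cite: BorceaBrandenLiggett2007, §3.2 (3.4)] -/
theorem coMinorWeight_bblMatrixB_add_one_two : coMinorWeight (bblMatrixB s t + 1) {2} = 15 / 4 := by
  rw [coMinorWeight_apply, show ({2} : Finset (Fin 3))ᶜ = {0, 1} by decide,
    principalMinorMap_pair _ (by decide), bblMatrixB_add_one]
  simp
  norm_num

/-- `A⟨1,3⟩ = a_22 = 2`. [cite: BorceaBrandenLiggett2007, §3.2 (3.4)] -/
theorem coMinorWeight_bblMatrixB_add_one_zero_two : coMinorWeight (bblMatrixB s t + 1) {0, 2} = 2 := by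
  rw [coMinorWeight_apply, show ({0, 2} : Finset (Fin 3))ᶜ = {1} by decide, principalMinorMap_singleton,
    bblMatrixB_add_one]
  simp

/-- **The Kotelyansky gap of `A = B + I` at `S = ∅`, `i = 1`, `j = 3` is the product of the two printed
almost-principal minors**: `A⟨1⟩ A⟨3⟩ − A⟨1,3⟩ A⟨∅⟩ = (B+I)(12,23) · (B+I)(23,12) = (1−2s)(1−2t)/16`.
[cite: BorceaBrandenLiggett2007, §3.2 ((3.4) and the Gantmacher–Krein–Carlson criterion)] -/
theorem koteljanskiiGap_bblMatrixB_add_one :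
    coMinorWeight (bblMatrixB s t + 1) {0} * coMinorWeight (bblMatrixB s t + 1) {2} -
        coMinorWeight (bblMatrixB s t + 1) {0, 2} * coMinorWeight (bblMatrixB s t + 1) ∅ =
      ((bblMatrixB s t + 1).submatrix ![0, 1] ![1, 2]).det * ((bblMatrixB s t + 1).submatrix ![1, 2] ![0, 1]).det := by
  rw [coMinorWeight_bblMatrixB_add_one_zero, coMinorWeight_bblMatrixB_add_one_two,
    coMinorWeight_bblMatrixB_add_one_zero_two, coMinorWeight_bblMatrixB_add_one_empty,
    det_bblMatrixB_add_one_rows01_cols12, det_bblMatrixB_add_one_rows12_cols01]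
  ring

end MatrixB

/-! ## §3 For `(1−2s)(1−2t) < 0`: `B + I` is not GKK, `B` is not Rayleigh, `μ_B` is not negatively associated -/

section Consequences

variable {s t : ℝ}

/-- **«We conclude that for such values of `s, t` the matrix `B + I` fails to be GKK»**: if
`(1−2s)(1−2t) < 0` (e.g. `s < 1/2 < t`), the Hadamard–Fischer–Kotelyansky inequality of `B + I` at `S = {1}`,
`T = {3}` fails. [cite: BorceaBrandenLiggett2007, §3.2] -/
theorem not_isGKK_bblMatrixB_add_one (h : (1 - 2 * s) * (1 - 2 * t) < 0) : ¬IsGKK (bblMatrixB s t + 1) := by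
  rintro ⟨-, hHFK⟩
  have key := hHFK {0} {2}
  rw [show ({0} : Finset (Fin 3)) ∪ {2} = {0, 2} by decide, show ({0} : Finset (Fin 3)) ∩ {2} = ∅ by decide] at key
  have gap := koteljanskiiGap_bblMatrixB_add_one s t
  rw [det_bblMatrixB_add_one_rows01_cols12, det_bblMatrixB_add_one_rows12_cols01] at gap
  nlinarith

/-- **`B` is totally positive (for `s, t ∈ (0,1)`) but NOT a Rayleigh matrix** when `(1−2s)(1−2t) < 0`: a Rayleigh
matrix plus a nonnegative diagonal matrix is GKK (Thm. 3.3). [cite: BorceaBrandenLiggett2007, §3.2 Thm. 3.3 with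
the discussion of (3.3)] -/
theorem not_isRayleighMatrix_bblMatrixB (h : (1 - 2 * s) * (1 - 2 * t) < 0) : ¬IsRayleighMatrix (bblMatrixB s t) := by
  intro hR
  have hG := (hR.add_diagonal (x := fun _ => (1 : ℝ)) fun _ => zero_le_one).isGKK
  rw [diagonal_one] at hG
  exact not_isGKK_bblMatrixB_add_one h hG

/-- The weight `μ_B` of the TP matrix `B` is not Rayleigh (`s, t ∈ (0,1)`, `(1−2s)(1−2t) < 0`; `B` IS a
P-matrix). [cite: BorceaBrandenLiggett2007, §3.2 Def. 3.1 with Thm. 3.3] -/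
theorem not_isRayleigh_coMinorWeight_bblMatrixB (hs0 : 0 < s) (hs1 : s < 1) (ht0 : 0 < t) (ht1 : t < 1)
    (h : (1 - 2 * s) * (1 - 2 * t) < 0) : ¬IsRayleigh (coMinorWeight (bblMatrixB s t)) :=
  fun hR => not_isRayleighMatrix_bblMatrixB h ⟨isPMatrix_bblMatrixB s t hs0 hs1 ht0 ht1, hR⟩

/-- **«the corresponding measure `μ_{B′}` will fail to have pairwise negatively correlated variables»** — here
with `B′ = B` (the failing instance of (3.4) has `S = ∅`): `μ_B` is not p-NC at the pair `(1,3)` when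
`(1−2s)(1−2t) < 0`. [cite: BorceaBrandenLiggett2007, §3.2 (after Question 3.2) with Def. 2.8] -/
theorem not_isPairwiseNC_coMinorWeight_bblMatrixB (h : (1 - 2 * s) * (1 - 2 * t) < 0) :
    ¬IsPairwiseNC (coMinorWeight (bblMatrixB s t)) := by
  intro hNC
  have key := hNC (x := (0 : Fin 3)) (y := 2) (by decide)
  rw [sum_filter_mem_mem_eq, sum_filter_mem_eq, sum_filter_mem_eq, sum_coMinorWeight_eq] at key
  have gap := koteljanskiiGap_bblMatrixB_add_one s t
  rw [det_bblMatrixB_add_one_rows01_cols12, det_bblMatrixB_add_one_rows12_cols01] at gap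
  nlinarith

/-- **«negative association fails for measures associated with totally positive matrices»**: `μ_B` is not
negatively associated (`(1−2s)(1−2t) < 0`), since NA ⟹ p-NC. [cite: BorceaBrandenLiggett2007, §3.2 (after
Question 3.2)] -/
theorem not_isNegAssoc_coMinorWeight_bblMatrixB (h : (1 - 2 * s) * (1 - 2 * t) < 0) :
    ¬IsNegAssoc (coMinorWeight (bblMatrixB s t)) :=
  fun hNA => not_isPairwiseNC_coMinorWeight_bblMatrixB h hNA.isPairwiseNC

/-- The printed choice exists: e.g. `s = 1/4`, `t = 3/4` give `(1−2s)(1−2t) = −1/4 < 0` with `s, t ∈ (0,1)`, so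
that `B` is TP, `B + I` is not GKK and `μ_B` is not negatively associated. [cite: BorceaBrandenLiggett2007, §3.2
(«we may choose s, t ∈ (0,1) so that (B+I)(12,23)(B+I)(23,12) < 0»)] -/
theorem bblMatrixB_example :
    IsTP (bblMatrixB (1 / 4) (3 / 4)) ∧ ¬IsGKK (bblMatrixB (1 / 4) (3 / 4) + 1) ∧
      ¬IsRayleighMatrix (bblMatrixB (1 / 4) (3 / 4)) ∧ ¬IsNegAssoc (coMinorWeight (bblMatrixB (1 / 4) (3 / 4))) := by
  have h : (1 - 2 * (1 / 4 : ℝ)) * (1 - 2 * (3 / 4)) < 0 := by norm_num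
  exact ⟨isTP_bblMatrixB _ _ (by norm_num) (by norm_num) (by norm_num) (by norm_num),
    not_isGKK_bblMatrixB_add_one h, not_isRayleighMatrix_bblMatrixB h, not_isNegAssoc_coMinorWeight_bblMatrixB h⟩

end Consequences

end Literature.Probability.NegativeDependence
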